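import Summits.Ventures.PercRepro2.CaseOnePendantQ
import Summits.Ventures.PercRepro2.CaseOneTForms

/-!
# The T-world forms propagate down a pendant edge by a pure scaling (blind cell PercRepro2, p1 g30)

For `a₃` a leaf at `v` through `e₀` (`o, a₁, a₂ ≠ a₃`): `{a₃ ∈ C₂} = {e₀ open} ∩ {v ∈ C₂}` and the leaf
edge is independent of every event among the other vertices, so the T-pair of `a₃` is `p(e₀)` times
the T-pair of `v` (**`Dt_leaf_at`**, **`Dto_leaf_at`**) — unlike the PD pair, which mixes the Q-pair
in (`Dpd_leaf_at`). With `iiExprT_of_leaf_at` (every `a₃`-mass is `p(e₀)` times the `v`-mass) and the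
linearity of the forms in the pair: `(ii-T)(a₃) = p(e₀)² · (ii-T)(v)`, so **`zSplitIIT_of_leaf_at`**
and **`zSplitIT_of_leaf_at`**: the T-world forms at `v` give them at every leaf `a₃` of `v`. Together
with K8 and its Q-side, the SIX forms `(ii), (ii-Q), (ii-T), (i), (i-Q), (i-T)` at `v` give the six forms
at a pendant `a₃` (**`sixForms_of_leaf_at`**) — the pendant step of a calculus with the `a₂`-edge rule
(`sixForms_of_a2_edge`). Own code; standard axioms.
-/

namespace Summit.Ventures.PercRepro2

namespace CaseOne

section TLeaf
variable {V : Type*} {E : Type*} [Fintype E] [DecidableEq E] {R : Type*} [CommRing R]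
variable {ends : E → Sym2 V} {v a₃ : V} {e₀ : E}

omit [Fintype E] in
/-- Membership in a connection event among vertices other than the leaf ignores the leaf edge. -/
lemma mem_connEvent_update_of_leaf' (hl : IsLeafAt ends v a₃ e₀) (ω : Config E) (c : Bool) {x y : V}
    (hx : x ≠ a₃) (hy : y ≠ a₃) :
    Function.update ω e₀ c ∈ connEvent ends x y ↔ ω ∈ connEvent ends x y := by
  simp only [mem_connEvent]
  rw [conn_iff_update_of_leaf hl (Function.update ω e₀ c) hx hy, Function.update_idem,
    conn_iff_update_of_leaf hl ω hx hy]

omit [Fintype E] in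
/-- An event whose membership ignores an edge has an indicator that ignores it. -/
lemma indicator_update_of_mem_iff {S : Set (Config E)} {e : E}
    (h : ∀ ω c, Function.update ω e c ∈ S ↔ ω ∈ S) :
    ∀ ω c, S.indicator (1 : Config E → R) (Function.update ω e c) = S.indicator 1 ω := by
  intro ω c
  by_cases hω : ω ∈ S
  · rw [Set.indicator_of_mem ((h ω c).2 hω), Set.indicator_of_mem hω]
    rfl
  · rw [Set.indicator_of_notMem (fun h' => hω ((h ω c).1 h')), Set.indicator_of_notMem hω]

/-- **`P(T)(a₃) = p(e₀) · P(T)(v)`** when `a₃` is a leaf at `v` (`a₁, a₂ ≠ a₃`). -/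
theorem Dt_leaf_at (p : E → R) (hl : IsLeafAt ends v a₃ e₀) (a₁ a₂ : V) (h1 : a₁ ≠ a₃)
    (h2 : a₂ ≠ a₃) : Dt p ends a₁ a₂ a₃ = p e₀ * Dt p ends a₁ a₂ v := by
  have hv : v ≠ a₃ := hl.ne
  unfold Dt
  rw [connEvent_leaf_at_eq hl h2]
  have e1 : openEdge e₀ ∩ connEvent ends a₂ v ∩ (connEvent ends a₁ a₂)ᶜ =
      (connEvent ends a₂ v ∩ (connEvent ends a₁ a₂)ᶜ) ∩ openEdge e₀ := by
    ext ω; simp only [Set.mem_inter_iff]; tauto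
  rw [e1, prob_inter_openEdge_of_ignore p e₀ _ (indicator_update_of_mem_iff (fun ω c => by
    simp only [Set.mem_inter_iff, Set.mem_compl_iff]
    rw [mem_connEvent_update_of_leaf' hl ω c h2 hv, mem_connEvent_update_of_leaf' hl ω c h1 h2]))]

/-- **`P(T, o ∈ U)(a₃) = p(e₀) · P(T, o ∈ U)(v)`** when `a₃` is a leaf at `v` (`o, a₁, a₂ ≠ a₃`). -/
theorem Dto_leaf_at (p : E → R) (hl : IsLeafAt ends v a₃ e₀) (o a₁ a₂ : V) (ho : o ≠ a₃)
    (h1 : a₁ ≠ a₃) (h2 : a₂ ≠ a₃) :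
    Dto p ends o a₁ a₂ a₃ = p e₀ * Dto p ends o a₁ a₂ v := by
  have hv : v ≠ a₃ := hl.ne
  unfold Dto
  rw [connEvent_leaf_at_eq hl h2]
  have e1 : (connEvent ends a₁ o ∪ connEvent ends a₂ o) ∩ (openEdge e₀ ∩ connEvent ends a₂ v) ∩
      (connEvent ends a₁ a₂)ᶜ =
      ((connEvent ends a₁ o ∪ connEvent ends a₂ o) ∩ connEvent ends a₂ v ∩ (connEvent ends a₁ a₂)ᶜ) ∩
        openEdge e₀ := by
    ext ω; simp only [Set.mem_inter_iff]; tauto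
  rw [e1, prob_inter_openEdge_of_ignore p e₀ _ (indicator_update_of_mem_iff (fun ω c => by
    simp only [Set.mem_inter_iff, Set.mem_union, Set.mem_compl_iff]
    rw [mem_connEvent_update_of_leaf' hl ω c h1 ho, mem_connEvent_update_of_leaf' hl ω c h2 ho,
      mem_connEvent_update_of_leaf' hl ω c h2 hv, mem_connEvent_update_of_leaf' hl ω c h1 h2]))]

end TLeaf

section TLeafForms
variable {V : Type*} {E : Type*} [Fintype E] [DecidableEq E]
  {R : Type*} [CommRing R] [LinearOrder R] [IsStrictOrderedRing R]
variable {ends : E → Sym2 V} {v a₃ : V} {e₀ : E}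

omit [LinearOrder R] [IsStrictOrderedRing R] in
/-- `iiExprT` is homogeneous in the pair. -/
lemma iiExprT_smul (p : E → R) (ends : E → Sym2 V) (o a₁ a₂ a₃ b : V) (t c₀ c₁ : R) :
    iiExprT p ends o a₁ a₂ a₃ b (t * c₀) (t * c₁) = t * iiExprT p ends o a₁ a₂ a₃ b c₀ c₁ := by
  rw [iiExprT_eq, iiExprT_eq]; ring

omit [LinearOrder R] [IsStrictOrderedRing R] in
/-- `iExprT` is homogeneous in the pair. -/
lemma iExprT_smul (p : E → R) (ends : E → Sym2 V) (o a₁ a₂ a₃ b : V) (t c₀ c₁ : R) :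
    iExprT p ends o a₁ a₂ a₃ b (t * c₀) (t * c₁) = t * iExprT p ends o a₁ a₂ a₃ b c₀ c₁ := by
  rw [iExprT_eq, iExprT_eq]; ring

/-- **`(ii-T)` propagates down a pendant edge**: `(ii-T)(a₃) = p(e₀)² · (ii-T)(v)`. -/
theorem zSplitIIT_of_leaf_at (p : E → R) (hp : IsProbVec p) (hl : IsLeafAt ends v a₃ e₀)
    (o a₁ a₂ b : V) (ho : o ≠ a₃) (h1 : a₁ ≠ a₃) (h2 : a₂ ≠ a₃) (hb : b ≠ a₃)
    (hT : ZSplitIIT p ends o a₁ a₂ v b) : ZSplitIIT p ends o a₁ a₂ a₃ b := by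
  unfold ZSplitIIT at hT ⊢
  rw [iiExprT_of_leaf_at p hl o a₁ a₂ b ho h1 h2 hb, Dto_leaf_at p hl o a₁ a₂ ho h1 h2,
    Dt_leaf_at p hl a₁ a₂ h1 h2, iiExprT_smul]
  have hp0 : 0 ≤ p e₀ := hp.nonneg e₀
  exact mul_nonneg hp0 (mul_nonneg hp0 hT)

/-- **`(i-T)` propagates down a pendant edge**: `(i-T)(a₃) = p(e₀)² · (i-T)(v)`. -/
theorem zSplitIT_of_leaf_at (p : E → R) (hp : IsProbVec p) (hl : IsLeafAt ends v a₃ e₀)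
    (o a₁ a₂ b : V) (ho : o ≠ a₃) (h1 : a₁ ≠ a₃) (h2 : a₂ ≠ a₃) (hb : b ≠ a₃)
    (hT : ZSplitIT p ends o a₁ a₂ v b) : ZSplitIT p ends o a₁ a₂ a₃ b := by
  unfold ZSplitIT at hT ⊢
  rw [iExprT_of_leaf_at p hl o a₁ a₂ b ho h1 h2 hb, Dto_leaf_at p hl o a₁ a₂ ho h1 h2,
    Dt_leaf_at p hl a₁ a₂ h1 h2, iExprT_smul]
  have hp0 : 0 ≤ p e₀ := hp.nonneg e₀
  exact mul_nonneg hp0 (mul_nonneg hp0 hT)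

/-- **The six forms propagate down a pendant edge** (K8, its Q-side, and the T-side). -/
theorem sixForms_of_leaf_at (p : E → R) (hp : IsProbVec p) (hl : IsLeafAt ends v a₃ e₀)
    (o a₁ a₂ b : V) (ho : o ≠ a₃) (h1 : a₁ ≠ a₃) (h2 : a₂ ≠ a₃) (hb : b ≠ a₃)
    (h : ZSplitII p ends o a₁ a₂ v b ∧ ZSplitIIQ p ends o a₁ a₂ v b ∧ ZSplitIIT p ends o a₁ a₂ v b ∧
      ZSplitI p ends o a₁ a₂ v b ∧ ZSplitIQ p ends o a₁ a₂ v b ∧ ZSplitIT p ends o a₁ a₂ v b) :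
    ZSplitII p ends o a₁ a₂ a₃ b ∧ ZSplitIIQ p ends o a₁ a₂ a₃ b ∧ ZSplitIIT p ends o a₁ a₂ a₃ b ∧
      ZSplitI p ends o a₁ a₂ a₃ b ∧ ZSplitIQ p ends o a₁ a₂ a₃ b ∧ ZSplitIT p ends o a₁ a₂ a₃ b := by
  obtain ⟨hII, hIIQ, hIIT, hI, hIQ, hIT⟩ := h
  exact ⟨zSplitII_of_leaf_at p hp hl o a₁ a₂ b ho h1 h2 hb hII hIIQ,
    zSplitIIQ_of_leaf_at p hp hl o a₁ a₂ b ho h1 h2 hb hIIQ,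
    zSplitIIT_of_leaf_at p hp hl o a₁ a₂ b ho h1 h2 hb hIIT,
    zSplitI_of_leaf_at p hp hl o a₁ a₂ b ho h1 h2 hb hI hIQ,
    zSplitIQ_of_leaf_at p hp hl o a₁ a₂ b ho h1 h2 hb hIQ,
    zSplitIT_of_leaf_at p hp hl o a₁ a₂ b ho h1 h2 hb hIT⟩

end TLeafForms

end CaseOne

end Summit.Ventures.PercRepro2
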